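import Literature.AlgebraicGeometry.Hu2025.Proofs.S03Pluecker.Orders
import Literature.AlgebraicGeometry.Hu2025.Proofs.S03Pluecker.Prop38
import HarnessLib

/-!
# Hu 2025 row 102 — `C20L34` HOLDS as typed (rev 2): Def 3.13's `<_℘` coincides on `𝕀^lt_{3,n}` with the printed bullet order of
# §2e.2 / §3.5 typed literally on the index shapes (`SummaryLT`) (typer res-type-009; kernel discharge)

**HONEST FRAMING (D-0012/D-0089).** [Hu2025] is an unrefereed preprint under adjudication; nothing of it is asserted. The typed claim
`C20L34 n` (Def. 3.14, chunk p0019 l.139–141; PDF p.42 l.13–14 «This order coincides with the order on 𝓕 described in §2e.2») is a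
statement about OUR two typed orders: `WpLT` (Def 3.13: `m`-rank, then `u ∖ m` by `<_lex`, then `u ∩ m`) and `SummaryLT` (the four
bullets of §3.5, p.43 l.18–22 = the three bullets of §2e.2, p.25 l.42–45, on the shapes `(i,a,b)` / `(a,b,c)`). This file proves it:
for `u, v ∈ 𝕀^lt_{3,n}` the two shapes are read off `u.1 ≤ 3`, the `m`-rank is `0`/`1` accordingly (`rkPrimary_eq`), `u ∖ m` is
`{b,c}` / `{a,b,c}`, `u ∩ m` is `{a}` / `∅`, and `<_lex` on sorted pairs / triples is the lexicographic order of the tuples.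
AI proof is weaker than expert review.
-/

namespace Literature.AlgebraicGeometry.Hu2025.Statements.S03Pluecker

variable {n : ℕ}

/-- `<_lex` on two sorted pairs `{b,c}`, `{b',c'}` of naturals is the lexicographic order of `(b,c)`, `(b',c')`.
[cite: Hu2025, Def. 3.11 (<_lex) p.41 l.4–12; Def. 3.14 (C20L34) p.42 l.13–14 (unrefereed preprint arXiv:2507.21400v1 under adjudication, D-0012/D-0089 — kernel support on OUR typed carriers of row 102; nothing of the source asserted)] -/
theorem lexLT_pair_iff {b c b' c' : ℕ} (hbc : b < c) (hbc' : b' < c') :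
    LexLT ({b, c} : Finset ℕ) {b', c'} ↔ b < b' ∨ (b = b' ∧ c < c') := by
  rw [lexLT_iff]
  simp only [Finset.mem_insert, Finset.mem_singleton]
  constructor
  · rintro ⟨x, hx, hxn, hall⟩
    have hb' := hall b' (Or.inl rfl)
    have hc' := hall c' (Or.inr rfl)
    rcases hx with rfl | rfl <;> omega
  · intro h
    rcases h with h | ⟨rfl, h⟩
    · exact ⟨b, Or.inl rfl, by omega, fun y hy _ => by omega⟩
    · exact ⟨c, Or.inr rfl, by omega, fun y hy hyn => by omega⟩

/-- `<_lex` on two sorted triples `{a,b,c}`, `{a',b',c'}` of naturals is the lexicographic order of the tuples.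
[cite: Hu2025, Def. 3.11 (<_lex) p.41 l.4–12; Def. 3.14 (C20L34) p.42 l.13–14 (unrefereed preprint arXiv:2507.21400v1 under adjudication, D-0012/D-0089 — kernel support on OUR typed carriers of row 102; nothing of the source asserted)] -/
theorem lexLT_triple_iff {a b c a' b' c' : ℕ} (hab : a < b) (hbc : b < c) (hab' : a' < b') (hbc' : b' < c') :
    LexLT ({a, b, c} : Finset ℕ) {a', b', c'} ↔ a < a' ∨ (a = a' ∧ (b < b' ∨ (b = b' ∧ c < c'))) := by
  rw [lexLT_iff]
  simp only [Finset.mem_insert, Finset.mem_singleton]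
  constructor
  · rintro ⟨x, hx, hxn, hall⟩
    have ha' := hall a' (Or.inl rfl)
    have hb' := hall b' (Or.inr (Or.inl rfl))
    have hc' := hall c' (Or.inr (Or.inr rfl))
    rcases hx with rfl | rfl | rfl <;> omega
  · intro h
    rcases h with h | ⟨rfl, h⟩
    · exact ⟨a, Or.inl rfl, by omega, fun y hy _ => by omega⟩
    · rcases h with h | ⟨rfl, h⟩
      · exact ⟨b, Or.inr (Or.inl rfl), by omega, fun y hy hyn => by omega⟩
      · exact ⟨c, Or.inr (Or.inr rfl), by omega, fun y hy hyn => by omega⟩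

/-- `<_lex` on singletons.
[cite: Hu2025, Def. 3.11 (<_lex) p.41 l.4–12; Def. 3.14 (C20L34) p.42 l.13–14 (unrefereed preprint arXiv:2507.21400v1 under adjudication, D-0012/D-0089 — kernel support on OUR typed carriers of row 102; nothing of the source asserted)] -/
theorem lexLT_singleton_iff {a a' : ℕ} : LexLT ({a} : Finset ℕ) {a'} ↔ a < a' := by
  rw [lexLT_iff]
  simp only [Finset.mem_singleton]
  constructor
  · rintro ⟨x, rfl, hxn, hall⟩
    have := hall a' rfl
    omega
  · intro h
    exact ⟨a, rfl, by omega, fun y hy _ => by omega⟩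

/-- `<_lex` is irreflexive on `∅` (no witness).
[cite: Hu2025, Def. 3.11 (<_lex) p.41 l.4–12; Def. 3.14 (C20L34) p.42 l.13–14 (unrefereed preprint arXiv:2507.21400v1 under adjudication, D-0012/D-0089 — kernel support on OUR typed carriers of row 102; nothing of the source asserted)] -/
theorem not_lexLT_empty : ¬ LexLT (∅ : Finset ℕ) ∅ := by
  rw [lexLT_iff]; simp

/-- Shape bookkeeping for `u = (a,b,c) ∈ 𝕀^lt_{3,n}`: `u ∖ m` and `m ∩ u` by the shape `a ≤ 3` / `3 < a`.
[cite: Hu2025, Def. 3.13 (u ∖ m, u ∩ m) p.42 l.3–8 (unrefereed preprint arXiv:2507.21400v1 under adjudication, D-0012/D-0089 — kernel support on OUR typed carriers of row 102; nothing of the source asserted)] -/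
theorem sdiff_inter_shape {a b c : ℕ} (ha : 1 ≤ a) (hab : a < b) (hb : 3 < b) (hbc : b < c) :
    (triSet (a, b, c) \ mSet = if a ≤ 3 then ({b, c} : Finset ℕ) else {a, b, c}) ∧
    (mSet ∩ triSet (a, b, c) = if a ≤ 3 then ({a} : Finset ℕ) else ∅) := by
  constructor
  · ext x
    simp only [triSet, mSet, Finset.mem_sdiff, Finset.mem_insert, Finset.mem_singleton]
    split_ifs with h3 <;> simp only [Finset.mem_insert, Finset.mem_singleton] <;> omega
  · ext x
    simp only [triSet, mSet, Finset.mem_inter, Finset.mem_insert, Finset.mem_singleton]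
    split_ifs with h3
    · simp only [Finset.mem_singleton]; omega
    · simp only [Finset.notMem_empty, iff_false]; omega

/-- **`C20L34` HOLDS** (rev-2 typing): on `𝕀^lt_{3,n}`, `WpLT u v ↔ SummaryLT u v`.
[cite: Hu2025, Def. 3.14 «This order coincides with the order on 𝓕 described in §2e.2» (chunk p0019 l.139–141; PDF p.42 l.13–14); §3.5 bullets p.43 l.18–22; §2e.2 p.25 l.42–45 (unrefereed preprint arXiv:2507.21400v1 under adjudication, D-0012/D-0089 — kernel proof about OUR typed orders of row 102; nothing of the source asserted)] -/
theorem C20L34_holds : C20L34 n := by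
  rintro ⟨a, b, c⟩ hu ⟨a', b', c'⟩ hv hlt hlt'
  have hidx := mem_plIndexSet_iff.mp hu
  have hidx' := mem_plIndexSet_iff.mp hv
  simp only at hidx hidx'
  have hb3 : 3 < b := three_lt_of_isLt (n := n) hu hlt
  have hb3' : 3 < b' := three_lt_of_isLt (n := n) hv hlt'
  have hr : rkPrimary (a, b, c) = if 3 < a then 1 else 0 := rkPrimary_eq (by simp; omega) hlt
  have hr' : rkPrimary (a', b', c') = if 3 < a' then 1 else 0 := rkPrimary_eq (by simp; omega) hlt'
  obtain ⟨hs, hi⟩ := sdiff_inter_shape (a := a) (b := b) (c := c) hidx.1.1 hidx.2.2.1 hb3 hidx.2.2.2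
  obtain ⟨hs', hi'⟩ := sdiff_inter_shape (a := a') (b := b') (c := c') hidx'.1.1 hidx'.2.2.1 hb3' hidx'.2.2.2
  unfold WpLT SummaryLT mRank
  rw [if_pos hlt, if_pos hlt', hr, hr', hs, hs', hi, hi']
  simp only
  by_cases h3 : a ≤ 3 <;> by_cases h3' : a' ≤ 3
  · -- rank 0 / rank 0
    have e1 : ¬ (3 < a) := by omega
    have e2 : ¬ (3 < a') := by omega
    simp only [if_neg e1, if_neg e2, if_pos h3, if_pos h3', lexLT_pair_iff hidx.2.2.2 hidx'.2.2.2, lexLT_singleton_iff]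
    constructor
    · rintro (h | ⟨-, h⟩ | ⟨-, hset, h⟩)
      · simp at h
      · exact Or.inr (Or.inl ⟨h3, h3', Or.inl h⟩)
      · have hbb : b = b' ∧ c = c' := by
          have h1 : b ∈ ({b', c'} : Finset ℕ) := by rw [← hset]; simp
          have h2 : c ∈ ({b', c'} : Finset ℕ) := by rw [← hset]; simp
          simp only [Finset.mem_insert, Finset.mem_singleton] at h1 h2
          omega
        exact Or.inr (Or.inl ⟨h3, h3', Or.inr ⟨by rw [hbb.1, hbb.2], h⟩⟩)
    · rintro (⟨-, h⟩ | ⟨-, -, h⟩ | ⟨h, -⟩)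
      · omega
      · rcases h with h | ⟨hbc, h⟩
        · exact Or.inr (Or.inl ⟨by simp, h⟩)
        · simp only [Prod.mk.injEq] at hbc
          refine Or.inr (Or.inr ⟨by simp, by rw [hbc.1, hbc.2], h⟩)
      · omega
  · -- rank 0 / rank 1
    have e1 : ¬ (3 < a) := by omega
    have e2 : (3 < a') := by omega
    simp only [if_neg e1, if_pos e2, if_pos h3, if_neg h3']
    constructor
    · intro; exact Or.inl ⟨h3, e2⟩
    · intro; exact Or.inl (by norm_num)
  · -- rank 1 / rank 0
    have e1 : (3 < a) := by omega
    have e2 : ¬ (3 < a') := by omega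
    simp only [if_pos e1, if_neg e2, if_neg h3, if_pos h3']
    constructor
    · rintro (h | ⟨h, -⟩ | ⟨h, -⟩) <;> simp at h
    · rintro (⟨h, -⟩ | ⟨h, -⟩ | ⟨-, h, -⟩) <;> omega
  · -- rank 1 / rank 1
    have e1 : (3 < a) := by omega
    have e2 : (3 < a') := by omega
    simp only [if_pos e1, if_pos e2, if_neg h3, if_neg h3',
      lexLT_triple_iff hidx.2.2.1 hidx.2.2.2 hidx'.2.2.1 hidx'.2.2.2, not_lexLT_empty]
    constructor
    · rintro (h | ⟨-, h⟩ | ⟨-, -, h⟩)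
      · simp at h
      · exact Or.inr (Or.inr ⟨e1, e2, h⟩)
      · exact absurd h (by simp)
    · rintro (⟨h, -⟩ | ⟨h, -⟩ | ⟨-, -, h⟩)
      · omega
      · omega
      · exact Or.inr (Or.inl ⟨by simp, h⟩)

end Literature.AlgebraicGeometry.Hu2025.Statements.S03Pluecker
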